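import Mathlib.Probability.Kernel.Invariance
import Mathlib.Probability.Kernel.Composition.IntegralCompProd
import Mathlib.Probability.Kernel.Composition.MeasureComp
import Mathlib.MeasureTheory.Measure.Sub
import Mathlib.Analysis.SpecificLimits.Basic
import HarnessLib

/-!
# Harris' ergodic theorem in the form of Hairer–Mattingly (2011)

Trunk T-STOCH (Literature/Probability/Process). Theorems only (no new definitions). For a Markov
kernel `P` on a measurable space `X` with a Lyapunov function `V : X → ℝ≥0` satisfying the
geometric drift condition `PV ≤ γV + K` (`γ < 1`; Hairer–Mattingly, Assumption 1) and the
minorisation `P(x, ·) ≥ α ν` on the sublevel set `{V ≤ R}`, `R > 2K/(1-γ)` (Assumption 2), we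
prove:

* `Literature.Probability.Process.Harris.abs_integral_sub_integral_le` — **Hairer–Mattingly 2011,
  Theorem 3.1 (= Theorem 1.3 in its function form), with the printed constants**: for
  `α₀ < α`, `β > 0` with `βK ≤ α₀`, and `ᾱ = (1 - α + α₀) ∨ γ ∨ (2 + Rβγ₀)/(2 + Rβ)`,
  `γ₀ = γ + 2K/R`, the operator `P` contracts the Lipschitz seminorm of the metric
  `d_β(x, y) = 2 + βV(x) + βV(y)` (`x ≠ y`): if `|φ(x) - φ(y)| ≤ M d_β(x, y)` for all `x, y` then
  `|Pφ(x) - Pφ(y)| ≤ ᾱ M d_β(x, y)`; and `ᾱ < 1` (`contractionFactor_lt_one`).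
* `….abs_integral_pow_sub_le` — the iterate: `|Pⁿφ(x) - Pⁿφ(y)| ≤ ᾱⁿ M d_β(x, y)`.
* `….lintegral_le_of_invariant` — every invariant PROBABILITY measure `μ` of `P` has
  `∫ V dμ ≤ K/(1-γ)` (drift condition alone).
* `….invariant_unique` — **uniqueness** of the invariant probability measure (Theorem 1.2,
  uniqueness half), among ALL invariant probability measures.
* `….abs_integral_pow_sub_integral_le` — **geometric convergence** (Theorem 1.2, convergence
  half): for an invariant probability measure `μ⋆` and `|φ(x) - φ(y)| ≤ M d_β(x,y)`,
  `|Pⁿφ(x) - μ⋆(φ)| ≤ ᾱⁿ M (2 + βV(x) + β μ⋆(V))`; in particular for `|φ| ≤ 1 + βV` (`M = 1`).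
* `….harris` — the packaged statement: under Assumptions 1–2 there are `ᾱ ∈ (0,1)` and `β > 0`
  with all of the above.

## What is NOT here

The EXISTENCE of an invariant probability measure (Hairer–Mattingly, Theorem 3.2: `Pⁿδ_x` is
Cauchy for the complete weighted total-variation metric) is not proved here; in the tree it is
supplied, for Feller semigroups with a Lyapunov function, by the Krylov–Bogoliubov theorem
(`Literature/Probability/Process/KrylovBogoliubov.lean`). The dual (measure) formulation of
Theorem 1.3 (`ρ_β(Pμ₁, Pμ₂) ≤ ᾱ ρ_β(μ₁, μ₂)`, Lemma 2.1 `ρ_β = weighted total variation`) is not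
formalised either; the function form and its consequences above are what Harris-type
applications (e.g. Cuneo–Eckmann–Hairer–Rey-Bellet 2018, Prop. 3.8) consume.

## Proof (Hairer–Mattingly 2011, §2–3)

Lemma 2.1 (half): a `d_β`-Lipschitz `φ` can be recentred, `|φ + c| ≤ M(1 + βV)` with
`c = inf_x (M(1 + βV(x)) - φ(x))` (`exists_abs_add_const_le`). Then (proof of Thm 3.1, p. 4):
if `V(x) + V(y) ≥ R`, `|Pφ(x) - Pφ(y)| ≤ 2M + Mβ(PV(x) + PV(y)) ≤ M(2 + βγ(V(x)+V(y)) + 2βK)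
≤ γ₁ M d_β(x,y)`; if `V(x) + V(y) ≤ R`, both points are in the small set, `P(x,·) = ρ_x + αν`
with `ρ_x ≥ 0` of mass `1 - α` (Mathlib's truncated subtraction of measures,
`Measure.sub_add_cancel_of_le`), the `αν`-parts cancel and
`|Pφ(x) - Pφ(y)| ≤ 2M(1-α) + Mβ(PV(x) + PV(y)) ≤ M(2(1 - α + α₀) + βγ(V(x)+V(y)))
≤ γ₂ M d_β(x,y)` using `βK ≤ α₀`. The corollaries integrate the iterated bound against invariant
measures; the finiteness `∫ V dμ ≤ K/(1-γ)` of every invariant probability measure is the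
truncation argument `∫ (V ∧ m) dμ = ∫ Pⁿ(V ∧ m) dμ ≤ ∫ ((γⁿV + K/(1-γ)) ∧ m) dμ → ∫ (K/(1-γ) ∧ m) dμ`.

## References

* M. Hairer, J. C. Mattingly, *Yet another look at Harris' ergodic theorem for Markov chains*,
  Seminar on Stochastic Analysis, Random Fields and Applications VI, Progr. Probab. 63,
  Birkhäuser (2011) 109–117 (arXiv:0810.2777): Assumptions 1–2, Theorems 1.2, 1.3, Lemma 2.1,
  Theorem 3.1 (with its proof), Theorem 3.2.
* S. P. Meyn, R. L. Tweedie, *Markov Chains and Stochastic Stability*, Springer (1993), Ch. 15–16.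

## Design choices

* `P : Kernel X X` with `[IsMarkovKernel P]`; iterates are Mathlib's monoid powers `P ^ n`
  (`Kernel.pow_add`, Chapman–Kolmogorov); invariance is Mathlib's `Kernel.Invariant P μ`
  (`μ.bind P = μ`).
* `V : X → ℝ≥0` (finite everywhere, Hairer–Mattingly Remark 1.1), drift and minorisation constants
  `γ K α R : ℝ≥0`; expectations of `V` are Lebesgue integrals `∫⁻` (no integrability side
  conditions), test functions `φ : X → ℝ` are measurable and real-valued, their expectations
  Bochner integrals (all integrable by the affine bounds proved here, so no junk values occur).
* The Lipschitz condition is required for ALL pairs `(x, y)` (for `x = y` it is vacuous), which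
  avoids mentioning the metric `d_β` as a separate definition.
-/

noncomputable section

open MeasureTheory ProbabilityTheory Filter Set
open scoped NNReal ENNReal Topology

namespace Literature.Probability.Process.Harris

variable {X : Type*} [MeasurableSpace X]

/-! ### Generalities: powers of a Markov kernel, integrals against `κ ∘ₘ μ`, affine bounds -/

/-- Powers of a Markov kernel are Markov kernels. [folklore] -/
theorem isMarkovKernel_pow (P : Kernel X X) [IsMarkovKernel P] (n : ℕ) :
    IsMarkovKernel (P ^ n) := by
  induction n with
  | zero => rw [pow_zero]; change IsMarkovKernel Kernel.id; infer_instance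
  | succ n ih =>
    rw [pow_succ]
    change IsMarkovKernel ((P ^ n) ∘ₖ P)
    haveI := ih
    infer_instance

/-- The unit of the kernel monoid is the identity kernel. [folklore] -/
theorem one_eq_id : (1 : Kernel X X) = Kernel.id := rfl

/-- `P⁰(x, ·) = δ_x`. [folklore] -/
theorem pow_zero_apply (P : Kernel X X) (x : X) : (P ^ 0) x = Measure.dirac x := by
  rw [pow_zero]
  exact Kernel.id_apply x

/-- `Pⁿ⁺¹ = Pⁿ ∘ P` (first one step, then `n` steps). [folklore] -/
theorem pow_succ_eq_comp (P : Kernel X X) (n : ℕ) : P ^ (n + 1) = (P ^ n) ∘ₖ P := by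
  rw [pow_succ]; rfl

/-- `Pⁿ⁺¹ = P ∘ Pⁿ` (first `n` steps, then one step). [folklore] -/
theorem pow_succ_eq_comp' (P : Kernel X X) (n : ℕ) : P ^ (n + 1) = P ∘ₖ (P ^ n) := by
  rw [pow_succ']; rfl

/-- Integration against `κ ∘ₘ μ`: `∫ f d(κ ∘ₘ μ) = ∫ (∫ f dκ(x)) dμ(x)` for `f ∈ L¹(κ ∘ₘ μ)`
(Mathlib's `Kernel.integral_comp` through the constant kernel). [folklore] -/
theorem integral_comp_measure (κ : Kernel X X) (μ : Measure X) {f : X → ℝ}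
    (hf : Integrable f (κ ∘ₘ μ)) : ∫ y, f y ∂(κ ∘ₘ μ) = ∫ x, ∫ y, f y ∂(κ x) ∂μ := by
  have hint : Integrable f ((κ ∘ₖ Kernel.const Unit μ) ()) := by
    rwa [← Measure.comp_eq_comp_const_apply]
  rw [Measure.comp_eq_comp_const_apply, Kernel.integral_comp hint, Kernel.const_apply]

/-- An invariant measure is invariant under all powers of the kernel. [folklore] -/
theorem invariant_pow {P : Kernel X X} {μ : Measure X} (hμ : Kernel.Invariant P μ) (n : ℕ) :
    Kernel.Invariant (P ^ n) μ := by
  induction n with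
  | zero =>
    rw [pow_zero, one_eq_id]
    exact Measure.id_comp
  | succ n ih => rw [pow_succ_eq_comp]; exact ih.comp hμ

/-- Iterating the drift condition: if `PV ≤ aV + b` and `aB + b ≤ B` then `PⁿV ≤ aⁿV + B`.
[cite: HairerMattingly2011, Assumption 1] -/
theorem lintegral_pow_le (P : Kernel X X) [IsMarkovKernel P] {V : X → ℝ≥0∞} (hV : Measurable V)
    {a b B : ℝ≥0∞} (hB : a * B + b ≤ B) (hdrift : ∀ x, ∫⁻ y, V y ∂(P x) ≤ a * V x + b)
    (n : ℕ) (x : X) : ∫⁻ y, V y ∂((P ^ n) x) ≤ a ^ n * V x + B := by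
  induction n generalizing x with
  | zero =>
    rw [pow_zero_apply, lintegral_dirac' _ hV, pow_zero, one_mul]
    exact le_self_add
  | succ n ih =>
    haveI := isMarkovKernel_pow P n
    rw [pow_succ_eq_comp', Kernel.lintegral_comp _ _ _ hV]
    calc ∫⁻ z, ∫⁻ y, V y ∂(P z) ∂((P ^ n) x)
        ≤ ∫⁻ z, (a * V z + b) ∂((P ^ n) x) := lintegral_mono fun z => hdrift z
      _ = a * ∫⁻ z, V z ∂((P ^ n) x) + b := by
          rw [lintegral_add_right _ measurable_const, lintegral_const_mul _ hV, lintegral_const,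
            measure_univ, mul_one]
      _ ≤ a * (a ^ n * V x + B) + b := by gcongr; exact ih x
      _ = a ^ (n + 1) * V x + (a * B + b) := by ring
      _ ≤ a ^ (n + 1) * V x + B := add_le_add le_rfl hB

/-- The fixed bound `B = b/(1-a)` satisfies `aB + b = B` (`a < 1`, `b` finite). [folklore] -/
theorem fixedBound_eq {a b : ℝ≥0} (ha : a < 1) :
    (a : ℝ≥0∞) * ((b / (1 - a) : ℝ≥0) : ℝ≥0∞) + b = ((b / (1 - a) : ℝ≥0) : ℝ≥0∞) := by
  have h1 : (0 : ℝ≥0) < 1 - a := tsub_pos_of_lt ha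
  rw [← ENNReal.coe_mul, ← ENNReal.coe_add, ENNReal.coe_inj]
  rw [← NNReal.coe_inj, NNReal.coe_add, NNReal.coe_mul, NNReal.coe_div, NNReal.coe_sub ha.le,
    NNReal.coe_one]
  have h1' : (0 : ℝ) < 1 - a := by
    have := ha; rw [← NNReal.coe_lt_coe, NNReal.coe_one] at this; linarith
  field_simp
  ring

/-- Iterating the geometric drift condition `PV ≤ γV + K`, `γ < 1`:
`PⁿV ≤ γⁿ V + K/(1-γ)`. [cite: HairerMattingly2011, Assumption 1] -/
theorem lintegral_pow_le_of_drift (P : Kernel X X) [IsMarkovKernel P] {V : X → ℝ≥0}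
    (hV : Measurable V) {γ K : ℝ≥0} (hγ : γ < 1)
    (hdrift : ∀ x, ∫⁻ y, V y ∂(P x) ≤ (γ : ℝ≥0∞) * V x + K) (n : ℕ) (x : X) :
    ∫⁻ y, V y ∂((P ^ n) x) ≤ (γ : ℝ≥0∞) ^ n * V x + ((K / (1 - γ) : ℝ≥0) : ℝ≥0∞) :=
  lintegral_pow_le P (V := fun y => (V y : ℝ≥0∞)) hV.coe_nnreal_ennreal
    (fixedBound_eq hγ).le hdrift n x

/-- In particular `PⁿV(x) < ∞`. [folklore] -/
theorem lintegral_pow_ne_top (P : Kernel X X) [IsMarkovKernel P] {V : X → ℝ≥0}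
    (hV : Measurable V) {γ K : ℝ≥0} (hγ : γ < 1)
    (hdrift : ∀ x, ∫⁻ y, V y ∂(P x) ≤ (γ : ℝ≥0∞) * V x + K) (n : ℕ) (x : X) :
    ∫⁻ y, V y ∂((P ^ n) x) ≠ ∞ :=
  ne_top_of_le_ne_top (by simp [ENNReal.mul_eq_top, ENNReal.pow_eq_top_iff])
    (lintegral_pow_le_of_drift P hV hγ hdrift n x)

section Affine

variable {μ : Measure X} {V : X → ℝ≥0}

/-- `V` is integrable (as a real function) when `∫⁻ V dμ < ∞`. [folklore] -/
theorem integrable_coe_of_lintegral_ne_top (hV : Measurable V) (hVμ : ∫⁻ x, V x ∂μ ≠ ∞) :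
    Integrable (fun x => (V x : ℝ)) μ := by
  have := integrable_toReal_of_lintegral_ne_top hV.coe_nnreal_ennreal.aemeasurable hVμ
  simpa using this

/-- `∫ V dμ = (∫⁻ V dμ).toReal`. [folklore] -/
theorem integral_coe_eq_toReal (hV : Measurable V) :
    ∫ x, (V x : ℝ) ∂μ = (∫⁻ x, V x ∂μ).toReal := by
  have h := integral_toReal (μ := μ) (f := fun x => (V x : ℝ≥0∞))
    hV.coe_nnreal_ennreal.aemeasurable (ae_of_all _ fun x => ENNReal.coe_lt_top)
  simpa using h

variable [IsFiniteMeasure μ]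

/-- A measurable function with an affine bound `|φ| ≤ A + B V` is integrable when
`∫⁻ V dμ < ∞`. [folklore] -/
theorem integrable_of_abs_le_affine (hV : Measurable V) (hVμ : ∫⁻ x, V x ∂μ ≠ ∞) {φ : X → ℝ}
    (hφm : Measurable φ) {A B : ℝ} (hφ : ∀ x, |φ x| ≤ A + B * V x) : Integrable φ μ := by
  refine ((integrable_const A).add ((integrable_coe_of_lintegral_ne_top hV hVμ).const_mul B)).mono'
    hφm.aestronglyMeasurable (Eventually.of_forall fun x => ?_)
  rw [Real.norm_eq_abs]
  exact hφ x

/-- Bounding an integral through an affine bound: `|∫ φ dμ| ≤ A μ(X) + B ∫ V dμ` if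
`|φ| ≤ A + BV` with `A, B ≥ 0`. [folklore] -/
theorem abs_integral_le_of_abs_le_affine (hV : Measurable V) (hVμ : ∫⁻ x, V x ∂μ ≠ ∞)
    {φ : X → ℝ} (hφm : Measurable φ) {A B : ℝ} (hφ : ∀ x, |φ x| ≤ A + B * V x) :
    |∫ x, φ x ∂μ| ≤ A * μ.real univ + B * (∫⁻ x, V x ∂μ).toReal := by
  have hVi := integrable_coe_of_lintegral_ne_top hV hVμ
  calc |∫ x, φ x ∂μ| ≤ ∫ x, |φ x| ∂μ := abs_integral_le_integral_abs
    _ ≤ ∫ x, (A + B * V x) ∂μ := by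
        refine integral_mono (integrable_of_abs_le_affine hV hVμ hφm hφ).abs
          ((integrable_const A).add (hVi.const_mul B)) fun x => hφ x
    _ = A * μ.real univ + B * (∫⁻ x, V x ∂μ).toReal := by
        rw [integral_add (integrable_const A) (hVi.const_mul B), integral_const, integral_const_mul,
          integral_coe_eq_toReal hV, smul_eq_mul, mul_comm]

end Affine

/-! ### Hairer–Mattingly, Lemma 2.1 (recentring a `d_β`-Lipschitz function) -/

/-- **Hairer–Mattingly 2011, Lemma 2.1 (the half `inf_c ‖φ + c‖_β ≤ ⦀φ⦀_β`).** If
`|φ(x) - φ(y)| ≤ M(2 + βV(x) + βV(y))` for all `x, y`, then for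
`c = inf_x (M(1 + βV(x)) - φ(x))` one has `|φ(x) + c| ≤ M(1 + βV(x))` for all `x`.
[cite: HairerMattingly2011, Lemma 2.1] -/
theorem exists_abs_add_const_le {X : Type*} [Nonempty X] {V : X → ℝ≥0} {β M : ℝ} {φ : X → ℝ}
    (hφ : ∀ x y, |φ x - φ y| ≤ M * (2 + β * V x + β * V y)) :
    ∃ c : ℝ, ∀ x, |φ x + c| ≤ M * (1 + β * V x) := by
  obtain ⟨y₀⟩ := ‹Nonempty X›
  set g : X → ℝ := fun x => M * (1 + β * V x) - φ x with hg
  have hbdd : BddBelow (range g) := by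
    refine ⟨-(M * (1 + β * V y₀)) - φ y₀, ?_⟩
    rintro _ ⟨x, rfl⟩
    have h := (abs_le.1 (hφ x y₀)).2
    simp only [hg]
    linarith
  refine ⟨⨅ x, g x, fun x => abs_le.2 ⟨?_, ?_⟩⟩
  · have h : -(M * (1 + β * V x)) - φ x ≤ ⨅ y, g y := by
      refine le_ciInf fun y => ?_
      have h := (abs_le.1 (hφ y x)).2
      simp only [hg]
      linarith
    linarith
  · have h : (⨅ y, g y) ≤ g x := ciInf_le hbdd x
    simp only [hg] at h
    linarith

/-- A `d_β`-Lipschitz function is affinely bounded: `|φ(x)| ≤ (|φ(x₀)| + M(2 + βV(x₀))) + MβV(x)`.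
[folklore] -/
theorem abs_le_affine_of_lipschitz {X : Type*} {V : X → ℝ≥0} {β M : ℝ} {φ : X → ℝ}
    (hφ : ∀ x y, |φ x - φ y| ≤ M * (2 + β * V x + β * V y)) (x₀ x : X) :
    |φ x| ≤ (|φ x₀| + M * (2 + β * V x₀)) + (M * β) * V x := by
  have h := hφ x x₀
  have h1 : |φ x| ≤ |φ x₀| + |φ x - φ x₀| := by
    have := abs_add_le (φ x₀) (φ x - φ x₀); rwa [add_sub_cancel] at this
  linarith

/-! ### Hairer–Mattingly, Theorem 3.1: `P` contracts the `d_β`-Lipschitz seminorm -/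

section Contraction

variable (P : Kernel X X) [IsMarkovKernel P] {V : X → ℝ≥0}

omit [IsMarkovKernel P] in
/-- The drift bound in real form: `(PV)(x) ≤ γV(x) + K`. [folklore] -/
theorem toReal_lintegral_le_of_drift {γ K : ℝ≥0}
    (hdrift : ∀ x, ∫⁻ y, V y ∂(P x) ≤ (γ : ℝ≥0∞) * V x + K) (x : X) :
    (∫⁻ y, V y ∂(P x)).toReal ≤ γ * V x + K := by
  have h : ((γ : ℝ≥0∞) * V x + K) = ((γ * V x + K : ℝ≥0) : ℝ≥0∞) := by norm_cast
  have := ENNReal.toReal_mono (by rw [h]; exact ENNReal.coe_ne_top) (hdrift x)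
  rw [h, ENNReal.coe_toReal] at this
  exact_mod_cast this

omit [IsMarkovKernel P] in
/-- `PV(x) < ∞` under the drift condition. [folklore] -/
theorem lintegral_ne_top_of_drift {γ K : ℝ≥0}
    (hdrift : ∀ x, ∫⁻ y, V y ∂(P x) ≤ (γ : ℝ≥0∞) * V x + K) (x : X) :
    ∫⁻ y, V y ∂(P x) ≠ ∞ :=
  ne_top_of_le_ne_top (by simp [ENNReal.mul_eq_top]) (hdrift x)

/-- One-point bound: if `|ψ| ≤ M(1 + βV)` then `|Pψ(x)| ≤ M + Mβ PV(x)`. [folklore] -/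
theorem abs_integral_le_of_abs_le (hV : Measurable V) {x : X} (hx : ∫⁻ y, V y ∂(P x) ≠ ∞)
    {ψ : X → ℝ} (hψm : Measurable ψ) {M β : ℝ} (hψ : ∀ z, |ψ z| ≤ M * (1 + β * V z)) :
    |∫ z, ψ z ∂(P x)| ≤ M + M * β * (∫⁻ y, V y ∂(P x)).toReal := by
  have h := abs_integral_le_of_abs_le_affine (μ := P x) hV hx hψm (A := M) (B := M * β)
    (fun z => by have := hψ z; linarith [this])
  simpa [probReal_univ] using h

/-- **The small-set estimate** (Hairer–Mattingly, proof of Thm 3.1, second case): if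
`P(x,·) ≥ αν` and `P(y,·) ≥ αν` (`ν` a probability measure) and `|ψ| ≤ M(1 + βV)` with
`M, β ≥ 0`, then `|Pψ(x) - Pψ(y)| ≤ 2M(1 - α) + Mβ(PV(x) + PV(y))` — the `αν`-parts cancel.
[cite: HairerMattingly2011, Theorem 3.1 (proof)] -/
theorem abs_integral_sub_integral_le_of_minorization (hV : Measurable V)
    {ν : Measure X} [IsProbabilityMeasure ν] {α : ℝ≥0} {x y : X}
    (hxν : α • ν ≤ P x) (hyν : α • ν ≤ P y)
    (hx : ∫⁻ z, V z ∂(P x) ≠ ∞) (hy : ∫⁻ z, V z ∂(P y) ≠ ∞)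
    {ψ : X → ℝ} (hψm : Measurable ψ) {M β : ℝ} (hM : 0 ≤ M) (hβ : 0 ≤ β)
    (hψ : ∀ z, |ψ z| ≤ M * (1 + β * V z)) :
    |∫ z, ψ z ∂(P x) - ∫ z, ψ z ∂(P y)| ≤
      2 * M * (1 - α) + M * β * ((∫⁻ z, V z ∂(P x)).toReal + (∫⁻ z, V z ∂(P y)).toReal) := by
  -- `α ≤ 1`
  have hα1 : α ≤ 1 := by
    have h := Measure.le_iff'.1 hxν univ
    simp only [Measure.smul_apply, measure_univ, ENNReal.smul_def, smul_eq_mul, mul_one] at h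
    exact_mod_cast h
  -- the decomposition `P z = ρ_z + αν`
  have hdec : ∀ {w : X}, α • ν ≤ P w → ∫⁻ z, V z ∂(P w) ≠ ∞ →
      ∫ z, ψ z ∂(P w) = ∫ z, ψ z ∂(P w - α • ν) + ∫ z, ψ z ∂(α • ν) ∧
      |∫ z, ψ z ∂(P w - α • ν)| ≤ M * (1 - α) + M * β * (∫⁻ z, V z ∂(P w)).toReal := by
    intro w hw hwV
    have hψP : Integrable ψ (P w) := integrable_of_abs_le_affine hV hwV hψm
      (A := M) (B := M * β) (fun z => by have := hψ z; linarith [this])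
    have hsub : P w - α • ν ≤ P w := Measure.sub_le
    have h1 : Integrable ψ (P w - α • ν) := hψP.mono_measure hsub
    have h2 : Integrable ψ (α • ν) := hψP.mono_measure hw
    refine ⟨?_, ?_⟩
    · conv_lhs => rw [← Measure.sub_add_cancel_of_le hw]
      exact integral_add_measure h1 h2
    · have hρV : ∫⁻ z, V z ∂(P w - α • ν) ≠ ∞ :=
        ne_top_of_le_ne_top hwV (lintegral_mono' hsub le_rfl)
      have h := abs_integral_le_of_abs_le_affine (μ := P w - α • ν) hV hρV hψm (A := M)
        (B := M * β) (fun z => by have := hψ z; linarith [this])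
      have hmass : (P w - α • ν).real univ = 1 - α := by
        rw [measureReal_def, Measure.sub_apply MeasurableSet.univ hw, measure_univ,
          Measure.smul_apply, measure_univ, ENNReal.smul_def, smul_eq_mul, mul_one]
        rw [show (1 : ℝ≥0∞) - α = ((1 - α : ℝ≥0) : ℝ≥0∞) by
          rw [ENNReal.coe_sub, ENNReal.coe_one], ENNReal.coe_toReal, NNReal.coe_sub hα1,
          NNReal.coe_one]
      rw [hmass] at h
      refine h.trans (add_le_add le_rfl ?_)
      refine mul_le_mul_of_nonneg_left ?_ (mul_nonneg hM hβ)
      exact ENNReal.toReal_mono hwV (lintegral_mono' hsub le_rfl)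
  obtain ⟨hxd, hxb⟩ := hdec hxν hx
  obtain ⟨hyd, hyb⟩ := hdec hyν hy
  rw [hxd, hyd, add_sub_add_right_eq_sub]
  calc |∫ z, ψ z ∂(P x - α • ν) - ∫ z, ψ z ∂(P y - α • ν)|
      ≤ |∫ z, ψ z ∂(P x - α • ν)| + |∫ z, ψ z ∂(P y - α • ν)| := abs_sub _ _
    _ ≤ (M * (1 - α) + M * β * (∫⁻ z, V z ∂(P x)).toReal) +
          (M * (1 - α) + M * β * (∫⁻ z, V z ∂(P y)).toReal) := add_le_add hxb hyb
    _ = _ := by ring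

/-- The elementary inequality behind the first case of Thm 3.1: for `S ≥ R > 0`, `γ ≤ 1`,
`β, K ≥ 0`, `2 + βγS + 2βK ≤ γ₁ (2 + βS)` with `γ₁ = (2 + βR(γ + 2K/R))/(2 + βR)`.
[cite: HairerMattingly2011, Theorem 3.1 (proof)] -/
theorem far_aux {β γ K R S : ℝ} (hβ : 0 ≤ β) (hR : 0 < R) (hγ : γ ≤ 1) (hK : 0 ≤ K)
    (hS : R ≤ S) :
    2 + β * γ * S + 2 * β * K ≤ (2 + β * R * (γ + 2 * K / R)) / (2 + β * R) * (2 + β * S) := by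
  have hden : 0 < 2 + β * R := by positivity
  have hRne : R ≠ 0 := hR.ne'
  rw [div_mul_eq_mul_div, le_div_iff₀ hden]
  have hRg : β * R * (γ + 2 * K / R) = β * R * γ + 2 * β * K := by
    field_simp
  rw [hRg]
  have key : (2 + β * R * γ + 2 * β * K) * (2 + β * S) - (2 + β * γ * S + 2 * β * K) * (2 + β * R)
      = 2 * β * (S - R) * (1 - γ + β * K) := by ring
  have hnonneg : 0 ≤ 2 * β * (S - R) * (1 - γ + β * K) := by
    have h1 : 0 ≤ S - R := sub_nonneg.2 hS
    have h2 : 0 ≤ 1 - γ + β * K := by nlinarith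
    positivity
  linarith

/-- **Hairer–Mattingly 2011, Theorem 3.1 (Theorem 1.3 in function form), with the printed
constants.** Let `P` be a Markov kernel with `PV ≤ γV + K` (`γ < 1`) and `P(x, ·) ≥ αν` for
`V(x) ≤ R`, where `R > 2K/(1-γ)` and `ν` is a probability measure. Let `α₀ < α`, `β > 0` with
`βK ≤ α₀` (the paper takes `β = α₀/K`), `γ₀ = γ + 2K/R` and
`ᾱ = (1 - α + α₀) ∨ γ ∨ (2 + Rβγ₀)/(2 + Rβ)`. If `φ` is measurable with
`|φ(x) - φ(y)| ≤ M d_β(x,y)`, `d_β(x,y) = 2 + βV(x) + βV(y)`, `M ≥ 0`, then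
`|Pφ(x) - Pφ(y)| ≤ ᾱ M d_β(x, y)` for all `x, y` ("`⦀Pφ⦀_β ≤ ᾱ ⦀φ⦀_β`").
[cite: HairerMattingly2011, Theorem 3.1] -/
theorem abs_integral_sub_integral_le (hV : Measurable V) {γ K : ℝ≥0} (hγ : γ < 1)
    (hdrift : ∀ x, ∫⁻ y, V y ∂(P x) ≤ (γ : ℝ≥0∞) * V x + K)
    {ν : Measure X} [IsProbabilityMeasure ν] {α R : ℝ≥0} (hR : 2 * K < (1 - γ) * R)
    (hminor : ∀ x, V x ≤ R → α • ν ≤ P x)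
    {α₀ β : ℝ} (hβ : 0 < β) (hβK : β * K ≤ α₀)
    {φ : X → ℝ} (hφm : Measurable φ) {M : ℝ} (hM : 0 ≤ M)
    (hφ : ∀ x y, |φ x - φ y| ≤ M * (2 + β * V x + β * V y)) (x y : X) :
    |∫ z, φ z ∂(P x) - ∫ z, φ z ∂(P y)| ≤
      max (max (1 - α + α₀) γ) ((2 + β * R * (γ + 2 * K / R)) / (2 + β * R)) * M *
        (2 + β * V x + β * V y) := by
  haveI : Nonempty X := ⟨x⟩
  set abar : ℝ := max (max (1 - α + α₀) γ) ((2 + β * R * (γ + 2 * K / R)) / (2 + β * R))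
    with habar
  -- the constants
  have hγ1 : (γ : ℝ) ≤ 1 := by exact_mod_cast hγ.le
  have hK0 : (0 : ℝ) ≤ K := K.coe_nonneg
  have hR0 : (0 : ℝ) < R := by
    have hRne : R ≠ 0 := by rintro rfl; simp at hR
    exact NNReal.coe_pos.2 (pos_iff_ne_zero.2 hRne)
  have hγa : (γ : ℝ) ≤ abar := (le_max_right _ _).trans (le_max_left _ _)
  have h1a : 1 - (α : ℝ) + α₀ ≤ abar := (le_max_left _ _).trans (le_max_left _ _)
  have hqa : (2 + β * R * (γ + 2 * K / R)) / (2 + β * R) ≤ abar := le_max_right _ _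
  -- recentring (Lemma 2.1): `ψ = φ + c`, `|ψ| ≤ M(1 + βV)`
  obtain ⟨c, hc⟩ := exists_abs_add_const_le hφ
  set ψ : X → ℝ := fun z => φ z + c with hψ
  have hψm : Measurable ψ := hφm.add_const c
  have hVfin : ∀ w, ∫⁻ z, V z ∂(P w) ≠ ∞ := lintegral_ne_top_of_drift P hdrift
  have hφint : ∀ w, Integrable φ (P w) := fun w =>
    integrable_of_abs_le_affine hV (hVfin w) hφm (abs_le_affine_of_lipschitz hφ x)
  have hshift : ∀ w, ∫ z, ψ z ∂(P w) = ∫ z, φ z ∂(P w) + c := fun w => by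
    simp only [hψ]
    rw [integral_add (hφint w) (integrable_const c), integral_const, probReal_univ, one_smul]
  have hdiff : ∫ z, φ z ∂(P x) - ∫ z, φ z ∂(P y) = ∫ z, ψ z ∂(P x) - ∫ z, ψ z ∂(P y) := by
    rw [hshift, hshift]; ring
  rw [hdiff]
  have hPV : ∀ w, (∫⁻ z, V z ∂(P w)).toReal ≤ γ * V w + K := toReal_lintegral_le_of_drift P hdrift
  have hVx : (0 : ℝ) ≤ V x := (V x).coe_nonneg
  have hVy : (0 : ℝ) ≤ V y := (V y).coe_nonneg
  have hMβ : 0 ≤ M * β := mul_nonneg hM hβ.le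
  have hS0 : 0 ≤ β * V x + β * V y := by positivity
  by_cases hfar : (R : ℝ) ≤ V x + V y
  · -- first case: `V x + V y ≥ R`
    have e1 : |∫ z, ψ z ∂(P x)| ≤ M + M * β * (γ * V x + K) :=
      (abs_integral_le_of_abs_le P hV (hVfin x) hψm hc).trans
        (add_le_add le_rfl (mul_le_mul_of_nonneg_left (hPV x) hMβ))
    have e2 : |∫ z, ψ z ∂(P y)| ≤ M + M * β * (γ * V y + K) :=
      (abs_integral_le_of_abs_le P hV (hVfin y) hψm hc).trans
        (add_le_add le_rfl (mul_le_mul_of_nonneg_left (hPV y) hMβ))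
    calc |∫ z, ψ z ∂(P x) - ∫ z, ψ z ∂(P y)|
        ≤ |∫ z, ψ z ∂(P x)| + |∫ z, ψ z ∂(P y)| := abs_sub _ _
      _ ≤ (M + M * β * (γ * V x + K)) + (M + M * β * (γ * V y + K)) := add_le_add e1 e2
      _ = M * (2 + β * γ * (V x + V y) + 2 * β * K) := by ring
      _ ≤ M * ((2 + β * R * (γ + 2 * K / R)) / (2 + β * R) * (2 + β * (V x + V y))) :=
          mul_le_mul_of_nonneg_left (far_aux hβ.le hR0 hγ1 hK0 hfar) hM
      _ ≤ M * (abar * (2 + β * (V x + V y))) :=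
          mul_le_mul_of_nonneg_left (mul_le_mul_of_nonneg_right hqa (by positivity)) hM
      _ = abar * M * (2 + β * V x + β * V y) := by ring
  · -- second case: both points are in the small set `{V ≤ R}`
    have hfar' : (V x : ℝ) + V y < R := lt_of_not_ge hfar
    have hxR : V x ≤ R := by
      have : (V x : ℝ) ≤ R := by linarith
      exact_mod_cast this
    have hyR : V y ≤ R := by
      have : (V y : ℝ) ≤ R := by linarith
      exact_mod_cast this
    have h := abs_integral_sub_integral_le_of_minorization P hV (hminor x hxR) (hminor y hyR)
      (hVfin x) (hVfin y) hψm hM hβ.le hc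
    have h2 : 2 * (1 - (α : ℝ) + α₀) ≤ abar * 2 := by linarith
    have h3 : (γ : ℝ) * (β * V x + β * V y) ≤ abar * (β * V x + β * V y) :=
      mul_le_mul_of_nonneg_right hγa hS0
    calc |∫ z, ψ z ∂(P x) - ∫ z, ψ z ∂(P y)|
        ≤ 2 * M * (1 - α) + M * β * ((∫⁻ z, V z ∂(P x)).toReal + (∫⁻ z, V z ∂(P y)).toReal) := h
      _ ≤ 2 * M * (1 - α) + M * β * ((γ * V x + K) + (γ * V y + K)) :=
          add_le_add le_rfl (mul_le_mul_of_nonneg_left (add_le_add (hPV x) (hPV y)) hMβ)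
      _ = M * (2 * (1 - α) + 2 * (β * K) + γ * (β * V x + β * V y)) := by ring
      _ ≤ M * (2 * (1 - α + α₀) + γ * (β * V x + β * V y)) :=
          mul_le_mul_of_nonneg_left (by linarith) hM
      _ ≤ M * (abar * 2 + abar * (β * V x + β * V y)) :=
          mul_le_mul_of_nonneg_left (add_le_add h2 h3) hM
      _ = abar * M * (2 + β * V x + β * V y) := by ring

/-- The contraction factor `ᾱ = (1 - α + α₀) ∨ γ ∨ (2 + Rβγ₀)/(2 + Rβ)` of Theorem 3.1 is `< 1`
when `α₀ < α`, `γ < 1`, `R > 2K/(1-γ)` and `β > 0`. [cite: HairerMattingly2011, Theorem 3.1] -/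
theorem contractionFactor_lt_one {γ K α R : ℝ≥0} (hγ : γ < 1) (hR : 2 * K < (1 - γ) * R)
    {α₀ β : ℝ} (hα₀ : α₀ < α) (hβ : 0 < β) :
    max (max (1 - α + α₀) γ) ((2 + β * R * (γ + 2 * K / R)) / (2 + β * R)) < 1 := by
  have hγ1 : (γ : ℝ) < 1 := by exact_mod_cast hγ
  have h1 : ((2 * K : ℝ≥0) : ℝ) < (((1 - γ) * R : ℝ≥0) : ℝ) := by exact_mod_cast hR
  rw [NNReal.coe_mul, NNReal.coe_mul, NNReal.coe_sub hγ.le, NNReal.coe_one] at h1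
  push_cast at h1
  have hK0 : (0 : ℝ) ≤ K := K.coe_nonneg
  have hR0 : (0 : ℝ) < R := by
    have hRne : R ≠ 0 := by rintro rfl; simp at hR
    exact NNReal.coe_pos.2 (pos_iff_ne_zero.2 hRne)
  refine max_lt (max_lt (by linarith) hγ1) ?_
  have hden : 0 < 2 + β * R := by positivity
  rw [div_lt_one hden]
  have hγ₀ : (γ : ℝ) + 2 * K / R < 1 := by
    have : 2 * (K : ℝ) / R < 1 - γ := (div_lt_iff₀ hR0).2 (by linarith)
    linarith
  have hβR : 0 < β * R := by positivity
  have := mul_lt_mul_of_pos_left hγ₀ hβR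
  linarith

/-- The contraction factor `ᾱ` is positive (it dominates the positive quotient
`(2 + Rβγ₀)/(2 + Rβ)`). [folklore] -/
theorem contractionFactor_pos {γ K α R : ℝ≥0} {α₀ β : ℝ} (hβ : 0 < β) :
    0 < max (max (1 - α + α₀) γ) ((2 + β * R * (γ + 2 * K / R)) / (2 + β * R)) := by
  refine lt_max_of_lt_right (div_pos ?_ (by positivity))
  have : (0 : ℝ) ≤ β * R * (γ + 2 * K / R) := by positivity
  linarith

/-- **Hairer–Mattingly 2011, Theorem 3.1 / Theorem 1.3 (existential form).** Under the drift
condition `PV ≤ γV + K` (`γ < 1`) and the minorisation `P(x,·) ≥ αν` on `{V ≤ R}` with `α > 0`,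
`R > 2K/(1-γ)`, there exist `ᾱ ∈ (0, 1)` and `β > 0` such that `P` contracts the
`d_β`-Lipschitz seminorm by `ᾱ`: `|φ(x) - φ(y)| ≤ M d_β(x,y)` for all `x,y` implies
`|Pφ(x) - Pφ(y)| ≤ ᾱ M d_β(x,y)` for all `x, y` (`φ` measurable, `M ≥ 0`).
[cite: HairerMattingly2011, Theorem 1.3] -/
theorem exists_contraction (hV : Measurable V) {γ K : ℝ≥0} (hγ : γ < 1)
    (hdrift : ∀ x, ∫⁻ y, V y ∂(P x) ≤ (γ : ℝ≥0∞) * V x + K)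
    {ν : Measure X} [IsProbabilityMeasure ν] {α R : ℝ≥0} (hα : 0 < α)
    (hR : 2 * K < (1 - γ) * R) (hminor : ∀ x, V x ≤ R → α • ν ≤ P x) :
    ∃ abar β : ℝ, 0 < abar ∧ abar < 1 ∧ 0 < β ∧
      ∀ (φ : X → ℝ), Measurable φ → ∀ M : ℝ, 0 ≤ M →
        (∀ x y, |φ x - φ y| ≤ M * (2 + β * V x + β * V y)) →
        ∀ x y, |∫ z, φ z ∂(P x) - ∫ z, φ z ∂(P y)| ≤ abar * M * (2 + β * V x + β * V y) := by
  -- `α₀ = α/2`, `β = α/(2(K+1))`, so that `βK ≤ α₀ < α`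
  set α₀ : ℝ := α / 2 with hα₀
  set β : ℝ := α / (2 * (K + 1)) with hβdef
  have hα' : (0 : ℝ) < α := by exact_mod_cast hα
  have hK0 : (0 : ℝ) ≤ K := K.coe_nonneg
  have hβ : 0 < β := by positivity
  have hβK : β * K ≤ α₀ := by
    rw [hβdef, hα₀, div_mul_eq_mul_div, div_le_div_iff₀ (by positivity) (by positivity)]
    nlinarith
  have hα₀α : α₀ < α := by rw [hα₀]; linarith
  refine ⟨max (max (1 - α + α₀) γ) ((2 + β * R * (γ + 2 * K / R)) / (2 + β * R)), β,
    contractionFactor_pos hβ, contractionFactor_lt_one hγ hR hα₀α hβ, hβ,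
    fun φ hφm M hM hφ x y => ?_⟩
  exact abs_integral_sub_integral_le P hV hγ hdrift hR hminor hβ hβK hφm hM hφ x y

end Contraction

/-! ### Consequences: iterates, moments of invariant measures, uniqueness, convergence -/

section Consequences

variable (P : Kernel X X) [IsMarkovKernel P] {V : X → ℝ≥0} (hV : Measurable V)
  {γ K : ℝ≥0} (hγ : γ < 1) (hdrift : ∀ x, ∫⁻ y, V y ∂(P x) ≤ (γ : ℝ≥0∞) * V x + K)
  {abar β : ℝ} (hβ : 0 ≤ β)
  (hcontr : ∀ (φ : X → ℝ), Measurable φ → ∀ M : ℝ, 0 ≤ M →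
    (∀ x y, |φ x - φ y| ≤ M * (2 + β * V x + β * V y)) →
    ∀ x y, |∫ z, φ z ∂(P x) - ∫ z, φ z ∂(P y)| ≤ abar * M * (2 + β * V x + β * V y))

include hV hγ hdrift in
/-- A `d_β`-Lipschitz measurable function is integrable against every `Pⁿ(x, ·)`. [folklore] -/
theorem integrable_pow_of_lipschitz {M : ℝ} {φ : X → ℝ} (hφm : Measurable φ)
    (hφ : ∀ x y, |φ x - φ y| ≤ M * (2 + β * V x + β * V y)) (n : ℕ) (x : X) :
    Integrable φ ((P ^ n) x) := by
  haveI := isMarkovKernel_pow P n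
  exact integrable_of_abs_le_affine hV (lintegral_pow_ne_top P hV hγ hdrift n x) hφm
    (abs_le_affine_of_lipschitz hφ x)

include hV hγ hdrift hcontr in
/-- **Iterated contraction**: `|Pⁿφ(x) - Pⁿφ(y)| ≤ ᾱⁿ M d_β(x, y)` (`ᾱ ≥ 0`).
[cite: HairerMattingly2011, Theorem 1.3] -/
theorem abs_integral_pow_sub_le (habar : 0 ≤ abar) (n : ℕ) {φ : X → ℝ} (hφm : Measurable φ)
    {M : ℝ} (hM : 0 ≤ M) (hφ : ∀ x y, |φ x - φ y| ≤ M * (2 + β * V x + β * V y)) (x y : X) :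
    |∫ z, φ z ∂((P ^ n) x) - ∫ z, φ z ∂((P ^ n) y)| ≤ abar ^ n * M * (2 + β * V x + β * V y) := by
  induction n generalizing φ M with
  | zero =>
    rw [pow_zero_apply, pow_zero_apply, integral_dirac' _ _ hφm.stronglyMeasurable,
      integral_dirac' _ _ hφm.stronglyMeasurable, pow_zero, one_mul]
    exact hφ x y
  | succ n ih =>
    haveI := isMarkovKernel_pow P n
    -- `Pⁿ⁺¹ φ = Pⁿ (P φ)` and `Pφ` is `ᾱM`-Lipschitz
    have hPφm : Measurable fun w => ∫ z, φ z ∂(P w) :=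
      (hφm.stronglyMeasurable.integral_kernel (κ := P)).measurable
    have hPφ : ∀ x y, |(∫ z, φ z ∂(P x)) - ∫ z, φ z ∂(P y)| ≤
        abar * M * (2 + β * V x + β * V y) := hcontr φ hφm M hM hφ
    have hstep : ∀ w, ∫ z, φ z ∂((P ^ (n + 1)) w) = ∫ u, ∫ z, φ z ∂(P u) ∂((P ^ n) w) := by
      intro w
      have hint : Integrable φ (P ∘ₘ (P ^ n) w) := by
        have := integrable_pow_of_lipschitz P hV hγ hdrift hφm hφ (n + 1) w
        rwa [pow_succ_eq_comp', Kernel.comp_apply] at this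
      rw [pow_succ_eq_comp', Kernel.comp_apply]
      exact integral_comp_measure P ((P ^ n) w) hint
    rw [hstep, hstep]
    calc |∫ u, ∫ z, φ z ∂(P u) ∂((P ^ n) x) - ∫ u, ∫ z, φ z ∂(P u) ∂((P ^ n) y)|
        ≤ abar ^ n * (abar * M) * (2 + β * V x + β * V y) :=
          ih hPφm (mul_nonneg habar hM) hPφ
      _ = abar ^ (n + 1) * M * (2 + β * V x + β * V y) := by ring

include hV hγ hdrift in
/-- **Every invariant probability measure has a finite `V`-moment**: `∫ V dμ ≤ K/(1-γ)` if
`μP = μ`, `μ(X) = 1` and `PV ≤ γV + K` with `γ < 1` (truncate `V` at height `m`, use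
`∫ (V ∧ m) dμ = ∫ Pⁿ(V ∧ m) dμ ≤ ∫ ((γⁿV + K/(1-γ)) ∧ m) dμ` and let `n → ∞`, then `m → ∞`).
[cite: HairerMattingly2011, Theorem 3.2] -/
theorem lintegral_le_of_invariant {μ : Measure X} [IsProbabilityMeasure μ]
    (hμ : Kernel.Invariant P μ) :
    ∫⁻ x, V x ∂μ ≤ ((K / (1 - γ) : ℝ≥0) : ℝ≥0∞) := by
  set B : ℝ≥0∞ := ((K / (1 - γ) : ℝ≥0) : ℝ≥0∞) with hB
  -- truncations `V ∧ m`, `m : ℕ`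
  have htrunc : ∀ m : ℕ, ∫⁻ x, min (V x : ℝ≥0∞) m ∂μ ≤ B := by
    intro m
    have hWm : Measurable fun x => min (V x : ℝ≥0∞) m :=
      hV.coe_nnreal_ennreal.min measurable_const
    -- `∫ (V ∧ m) dμ ≤ ∫ ((γⁿ V + B) ∧ m) dμ` for every `n`
    have hn : ∀ n : ℕ, ∫⁻ x, min (V x : ℝ≥0∞) m ∂μ ≤
        ∫⁻ x, min ((γ : ℝ≥0∞) ^ n * V x + B) m ∂μ := by
      intro n
      haveI := isMarkovKernel_pow P n
      have hinv := (invariant_pow hμ n).def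
      calc ∫⁻ x, min (V x : ℝ≥0∞) m ∂μ = ∫⁻ x, min (V x : ℝ≥0∞) m ∂(μ.bind (P ^ n)) := by
            rw [hinv]
        _ = ∫⁻ x, ∫⁻ y, min (V y : ℝ≥0∞) m ∂((P ^ n) x) ∂μ :=
            Measure.lintegral_bind (Kernel.aemeasurable _) hWm.aemeasurable
        _ ≤ ∫⁻ x, min ((γ : ℝ≥0∞) ^ n * V x + B) m ∂μ := by
            refine lintegral_mono fun x => le_min ?_ ?_
            · exact (lintegral_mono fun y => min_le_left _ _).trans
                (lintegral_pow_le_of_drift P hV hγ hdrift n x)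
            · calc ∫⁻ y, min (V y : ℝ≥0∞) m ∂((P ^ n) x) ≤ ∫⁻ _, (m : ℝ≥0∞) ∂((P ^ n) x) :=
                    lintegral_mono fun y => min_le_right _ _
                _ = m := by rw [lintegral_const, measure_univ, mul_one]
    -- the right-hand side tends to `∫ (B ∧ m) dμ ≤ B` as `n → ∞`
    have hlim : Tendsto (fun n : ℕ => ∫⁻ x, min ((γ : ℝ≥0∞) ^ n * V x + B) m ∂μ) atTop
        (𝓝 (∫⁻ _, min B m ∂μ)) := by
      have hfin : ∫⁻ _, (m : ℝ≥0∞) ∂μ ≠ ∞ := by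
        rw [lintegral_const]
        exact ENNReal.mul_ne_top (ENNReal.natCast_ne_top m) (measure_ne_top _ _)
      refine tendsto_lintegral_of_dominated_convergence (fun _ => (m : ℝ≥0∞))
        (fun n => ((measurable_const.mul hV.coe_nnreal_ennreal).add measurable_const).min
          measurable_const)
        (fun n => ae_of_all _ fun x => min_le_right _ _) hfin (ae_of_all _ fun x => ?_)
      have hγ' : (γ : ℝ≥0∞) < 1 := by exact_mod_cast hγ
      have hγn : Tendsto (fun n : ℕ => (γ : ℝ≥0∞) ^ n * V x + B) atTop (𝓝 (0 * V x + B)) :=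
        (ENNReal.Tendsto.mul_const (ENNReal.tendsto_pow_atTop_nhds_zero_of_lt_one hγ')
          (Or.inr ENNReal.coe_ne_top)).add tendsto_const_nhds
      rw [zero_mul, zero_add] at hγn
      exact hγn.min tendsto_const_nhds
    have hle : ∫⁻ _, min B m ∂μ ≤ B := by
      calc ∫⁻ _, min B m ∂μ ≤ ∫⁻ _, B ∂μ := lintegral_mono fun x => min_le_left _ _
        _ = B := by rw [lintegral_const, measure_univ, mul_one]
    exact (ge_of_tendsto' hlim hn).trans hle
  -- monotone convergence in the truncation level `m → ∞`
  have hsup : (fun x => (V x : ℝ≥0∞)) = fun x => ⨆ m : ℕ, min (V x : ℝ≥0∞) m := by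
    funext x
    refine le_antisymm ?_ (iSup_le fun m => min_le_left _ _)
    obtain ⟨m, hm⟩ := exists_nat_ge (V x)
    refine le_iSup_of_le m ?_
    rw [min_eq_left (by exact_mod_cast hm)]
  have hmono : Monotone fun (m : ℕ) (x : X) => min (V x : ℝ≥0∞) m := by
    intro m m' hmm' x
    exact min_le_min le_rfl (by exact_mod_cast hmm')
  have hiSup := lintegral_iSup (μ := μ) (fun m : ℕ => hV.coe_nnreal_ennreal.min
    (measurable_const (a := (m : ℝ≥0∞)))) hmono
  rw [hsup, hiSup]
  exact iSup_le fun m => htrunc m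

include hV hγ hdrift in
/-- The `V`-moment of an invariant probability measure is finite. [folklore] -/
theorem lintegral_ne_top_of_invariant {μ : Measure X} [IsProbabilityMeasure μ]
    (hμ : Kernel.Invariant P μ) : ∫⁻ x, V x ∂μ ≠ ∞ :=
  ne_top_of_le_ne_top ENNReal.coe_ne_top (lintegral_le_of_invariant P hV hγ hdrift hμ)

include hV hγ hdrift hcontr in
/-- **Geometric convergence to an invariant probability measure** (Hairer–Mattingly 2011,
Theorem 1.2, convergence half, in `d_β`-Lipschitz form): if `μ⋆ P = μ⋆` and
`|φ(x) - φ(y)| ≤ M d_β(x,y)`, then `|Pⁿφ(x) - μ⋆(φ)| ≤ ᾱⁿ M (2 + βV(x) + β μ⋆(V))`.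
[cite: HairerMattingly2011, Theorem 1.2] -/
theorem abs_integral_pow_sub_integral_le (habar : 0 ≤ abar) {μ : Measure X}
    [IsProbabilityMeasure μ] (hμ : Kernel.Invariant P μ) (n : ℕ) {φ : X → ℝ}
    (hφm : Measurable φ) {M : ℝ} (hM : 0 ≤ M)
    (hφ : ∀ x y, |φ x - φ y| ≤ M * (2 + β * V x + β * V y)) (x : X) :
    |∫ z, φ z ∂((P ^ n) x) - ∫ z, φ z ∂μ| ≤
      abar ^ n * M * (2 + β * V x + β * (∫⁻ z, V z ∂μ).toReal) := by
  haveI := isMarkovKernel_pow P n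
  have hμV : ∫⁻ z, V z ∂μ ≠ ∞ := lintegral_ne_top_of_invariant P hV hγ hdrift hμ
  have hVi : Integrable (fun z => (V z : ℝ)) μ := integrable_coe_of_lintegral_ne_top hV hμV
  -- `g = Pⁿφ` and its Lipschitz bound
  set g : X → ℝ := fun w => ∫ z, φ z ∂((P ^ n) w) with hg
  have hgm : Measurable g := (hφm.stronglyMeasurable.integral_kernel (κ := P ^ n)).measurable
  have hgLip : ∀ u w, |g u - g w| ≤ abar ^ n * M * (2 + β * V u + β * V w) :=
    abs_integral_pow_sub_le P hV hγ hdrift hcontr habar n hφm hM hφ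
  -- `μ(φ) = μ(Pⁿφ)`
  have hφμ : Integrable φ μ :=
    integrable_of_abs_le_affine hV hμV hφm (abs_le_affine_of_lipschitz hφ x)
  have hinv : ∫ w, g w ∂μ = ∫ z, φ z ∂μ := by
    have h := (invariant_pow hμ n).def
    have hint : Integrable φ (μ.bind ⇑(P ^ n)) := by rw [h]; exact hφμ
    have e := integral_comp_measure (P ^ n) μ hint
    rw [h] at e
    exact e.symm
  rw [← hinv]
  -- `g x - ∫ g dμ = ∫ (g x - g w) dμ(w)`
  have hgi : Integrable g μ :=
    integrable_of_abs_le_affine hV hμV hgm (abs_le_affine_of_lipschitz hgLip x)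
  have hsub : g x - ∫ w, g w ∂μ = ∫ w, (g x - g w) ∂μ := by
    rw [integral_sub (integrable_const _) hgi, integral_const, probReal_univ, one_smul]
  change |g x - ∫ w, g w ∂μ| ≤ _
  rw [hsub]
  calc |∫ w, (g x - g w) ∂μ| ≤ ∫ w, |g x - g w| ∂μ := abs_integral_le_integral_abs
    _ ≤ ∫ w, abar ^ n * M * (2 + β * V x + β * V w) ∂μ := by
        refine integral_mono ((integrable_const _).sub hgi).abs ?_ fun w => hgLip x w
        exact ((integrable_const _).add (hVi.const_mul _)).const_mul _
    _ = abar ^ n * M * (2 + β * V x + β * (∫⁻ z, V z ∂μ).toReal) := by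
        rw [integral_const_mul, integral_add (integrable_const _) (hVi.const_mul _),
          integral_const, probReal_univ, one_smul, integral_const_mul, integral_coe_eq_toReal hV]

include hV hγ hdrift hβ hcontr in
/-- **Uniqueness of the invariant probability measure** (Hairer–Mattingly 2011, Theorem 1.2,
uniqueness half): two invariant probability measures of `P` coincide (both have finite
`V`-moment, and `|μ₁(A) - μ₂(A)| ≤ ᾱⁿ (1 + β(μ₁(V) + μ₂(V))/2) → 0` for every measurable `A`,
since `ᾱ < 1`). [cite: HairerMattingly2011, Theorem 1.2] -/
theorem invariant_unique (habar : 0 ≤ abar) (habar1 : abar < 1) {μ₁ μ₂ : Measure X}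
    [IsProbabilityMeasure μ₁] [IsProbabilityMeasure μ₂]
    (h₁ : Kernel.Invariant P μ₁) (h₂ : Kernel.Invariant P μ₂) : μ₁ = μ₂ := by
  have hV₁ : ∫⁻ z, V z ∂μ₁ ≠ ∞ := lintegral_ne_top_of_invariant P hV hγ hdrift h₁
  have hVi₁ : Integrable (fun z => (V z : ℝ)) μ₁ := integrable_coe_of_lintegral_ne_top hV hV₁
  refine Measure.ext fun A hA => ?_
  -- the indicator `φ` of `A` takes values in `[0, 1]`, so it is `d_β`-Lipschitz with `M = 1/2`
  have hφm : Measurable (A.indicator (1 : X → ℝ)) := measurable_one.indicator hA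
  have hφ01 : ∀ z, 0 ≤ A.indicator (1 : X → ℝ) z ∧ A.indicator (1 : X → ℝ) z ≤ 1 := by
    intro z
    by_cases hz : z ∈ A <;> simp [hz]
  have hφLip : ∀ x y, |A.indicator (1 : X → ℝ) x - A.indicator (1 : X → ℝ) y| ≤
      (1 / 2 : ℝ) * (2 + β * V x + β * V y) := by
    intro x y
    have hVx : (0 : ℝ) ≤ β * V x := mul_nonneg hβ (V x).coe_nonneg
    have hVy : (0 : ℝ) ≤ β * V y := mul_nonneg hβ (V y).coe_nonneg
    rw [abs_le]
    constructor <;> nlinarith [(hφ01 x).1, (hφ01 x).2, (hφ01 y).1, (hφ01 y).2]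
  -- `|μ₁(A) - μ₂(A)| ≤ ᾱⁿ/2 (2 + β μ₁(V) + β μ₂(V))` for every `n`
  have hkey : ∀ n : ℕ, |μ₁.real A - μ₂.real A| ≤
      abar ^ n * (1 / 2) * (2 + β * (∫⁻ z, V z ∂μ₁).toReal + β * (∫⁻ z, V z ∂μ₂).toReal) := by
    intro n
    haveI := isMarkovKernel_pow P n
    set g : X → ℝ := fun w => ∫ z, A.indicator (1 : X → ℝ) z ∂((P ^ n) w) with hg
    have hgm : Measurable g := (hφm.stronglyMeasurable.integral_kernel (κ := P ^ n)).measurable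
    -- geometric convergence towards `μ₂`, pointwise
    have hconv : ∀ x, |g x - ∫ z, A.indicator (1 : X → ℝ) z ∂μ₂| ≤
        abar ^ n * (1 / 2) * (2 + β * V x + β * (∫⁻ z, V z ∂μ₂).toReal) := fun x =>
      abs_integral_pow_sub_integral_le P hV hγ hdrift hcontr habar h₂ n hφm (by norm_num) hφLip x
    -- `μ₁(A) = ∫ Pⁿφ dμ₁` and `μ₂(A) = μ₂(φ)`
    have hφμ₁ : Integrable (A.indicator (1 : X → ℝ)) μ₁ :=
      integrable_of_abs_le_affine hV hV₁ hφm (A := 1) (B := 0) (fun z => by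
        rw [abs_of_nonneg (hφ01 z).1]; linarith [(hφ01 z).2])
    have h1 : ∫ w, g w ∂μ₁ = μ₁.real A := by
      have h := (invariant_pow h₁ n).def
      have hint : Integrable (A.indicator (1 : X → ℝ)) (μ₁.bind ⇑(P ^ n)) := by
        rw [h]; exact hφμ₁
      have e := integral_comp_measure (P ^ n) μ₁ hint
      rw [h, integral_indicator_one hA] at e
      exact e.symm
    have h2 : ∫ z, A.indicator (1 : X → ℝ) z ∂μ₂ = μ₂.real A := integral_indicator_one hA
    -- integrate the pointwise bound against `μ₁`
    have hgb : ∀ w, |g w| ≤ 1 + 0 * V w := by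
      intro w
      have hb : ∀ᵐ z ∂((P ^ n) w), ‖A.indicator (1 : X → ℝ) z‖ ≤ 1 := ae_of_all _ fun z => by
        rw [Real.norm_eq_abs, abs_of_nonneg (hφ01 z).1]; exact (hφ01 z).2
      have := norm_integral_le_of_norm_le_const hb
      rw [probReal_univ, mul_one, Real.norm_eq_abs] at this
      simpa using this
    have hgi : Integrable g μ₁ := integrable_of_abs_le_affine hV hV₁ hgm hgb
    have hsub : (∫ w, g w ∂μ₁) - ∫ z, A.indicator (1 : X → ℝ) z ∂μ₂ =
        ∫ w, (g w - ∫ z, A.indicator (1 : X → ℝ) z ∂μ₂) ∂μ₁ := by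
      rw [integral_sub hgi (integrable_const _), integral_const, probReal_univ, one_smul]
    rw [← h1, ← h2, hsub]
    calc |∫ w, (g w - ∫ z, A.indicator (1 : X → ℝ) z ∂μ₂) ∂μ₁|
        ≤ ∫ w, |g w - ∫ z, A.indicator (1 : X → ℝ) z ∂μ₂| ∂μ₁ := abs_integral_le_integral_abs
      _ ≤ ∫ w, abar ^ n * (1 / 2) * (2 + β * V w + β * (∫⁻ z, V z ∂μ₂).toReal) ∂μ₁ := by
          refine integral_mono (hgi.sub (integrable_const _)).abs ?_ fun w => hconv w
          exact (((integrable_const _).add (hVi₁.const_mul _)).add (integrable_const _)).const_mul _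
      _ = abar ^ n * (1 / 2) *
            (2 + β * (∫⁻ z, V z ∂μ₁).toReal + β * (∫⁻ z, V z ∂μ₂).toReal) := by
          have h12 : Integrable (fun a => (2 : ℝ) + β * V a) μ₁ :=
            (integrable_const _).add (hVi₁.const_mul _)
          rw [integral_const_mul, integral_add h12 (integrable_const _),
            integral_add (integrable_const _) (hVi₁.const_mul _),
            integral_const, integral_const, probReal_univ, one_smul, one_smul,
            integral_const_mul, integral_coe_eq_toReal hV]
  -- let `n → ∞`
  have hlim : Tendsto (fun n : ℕ => abar ^ n * (1 / 2) *
      (2 + β * (∫⁻ z, V z ∂μ₁).toReal + β * (∫⁻ z, V z ∂μ₂).toReal)) atTop (𝓝 0) := by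
    have h := ((tendsto_pow_atTop_nhds_zero_of_lt_one habar habar1).mul_const (1 / 2 : ℝ)).mul_const
      (2 + β * (∫⁻ z, V z ∂μ₁).toReal + β * (∫⁻ z, V z ∂μ₂).toReal)
    simpa using h
  have h0 : |μ₁.real A - μ₂.real A| ≤ 0 := ge_of_tendsto' hlim hkey
  have heq : μ₁.real A = μ₂.real A := by
    have := abs_nonpos_iff.1 h0
    linarith
  rw [measureReal_def, measureReal_def] at heq
  exact (ENNReal.toReal_eq_toReal_iff' (measure_ne_top μ₁ A) (measure_ne_top μ₂ A)).1 heq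

end Consequences

/-! ### The packaged theorem -/

/-- **Harris' ergodic theorem in the form of Hairer–Mattingly 2011 (Theorems 1.2–1.3, without the
existence part).** Let `P` be a Markov kernel on a measurable space, `V ≥ 0` measurable with
`PV ≤ γV + K`, `γ < 1` (Assumption 1), and `P(x, ·) ≥ αν` for all `x` with `V(x) ≤ R`, where
`α > 0`, `ν` is a probability measure and `R > 2K/(1-γ)` (Assumption 2). Then there are
`ᾱ ∈ (0,1)` and `β > 0` such that:
(i) `⦀Pφ⦀_β ≤ ᾱ⦀φ⦀_β`: `|φ(x)-φ(y)| ≤ M d_β(x,y)` for all `x, y` implies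
`|Pⁿφ(x) - Pⁿφ(y)| ≤ ᾱⁿ M d_β(x,y)`, `d_β(x,y) = 2 + βV(x) + βV(y)`;
(ii) `P` has at most one invariant probability measure;
(iii) for every invariant probability measure `μ⋆`: `∫ V dμ⋆ ≤ K/(1-γ)`, and for every
measurable `φ` with `|φ| ≤ 1 + βV` and all `n, x`,
`|Pⁿφ(x) - μ⋆(φ)| ≤ ᾱⁿ (2 + βV(x) + β μ⋆(V))` ("`‖Pⁿφ - μ⋆(φ)‖ ≤ C ᾱⁿ ‖φ‖`").
Existence of `μ⋆` (Theorem 3.2) is not part of this statement.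
[cite: HairerMattingly2011, Theorems 1.2 and 1.3] -/
theorem harris (P : Kernel X X) [IsMarkovKernel P] {V : X → ℝ≥0} (hV : Measurable V)
    {γ K : ℝ≥0} (hγ : γ < 1) (hdrift : ∀ x, ∫⁻ y, V y ∂(P x) ≤ (γ : ℝ≥0∞) * V x + K)
    {ν : Measure X} [IsProbabilityMeasure ν] {α R : ℝ≥0} (hα : 0 < α)
    (hR : 2 * K < (1 - γ) * R) (hminor : ∀ x, V x ≤ R → α • ν ≤ P x) :
    ∃ abar β : ℝ, 0 < abar ∧ abar < 1 ∧ 0 < β ∧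
      -- (i) contraction of the `d_β`-Lipschitz seminorm, iterated
      (∀ (n : ℕ) (φ : X → ℝ), Measurable φ → ∀ M : ℝ, 0 ≤ M →
        (∀ x y, |φ x - φ y| ≤ M * (2 + β * V x + β * V y)) →
        ∀ x y, |∫ z, φ z ∂((P ^ n) x) - ∫ z, φ z ∂((P ^ n) y)| ≤
          abar ^ n * M * (2 + β * V x + β * V y)) ∧
      -- (ii) uniqueness of the invariant probability measure
      (∀ μ₁ μ₂ : Measure X, IsProbabilityMeasure μ₁ → IsProbabilityMeasure μ₂ →
        Kernel.Invariant P μ₁ → Kernel.Invariant P μ₂ → μ₁ = μ₂) ∧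
      -- (iii) moments and geometric convergence
      (∀ μ : Measure X, IsProbabilityMeasure μ → Kernel.Invariant P μ →
        ∫⁻ x, V x ∂μ ≤ ((K / (1 - γ) : ℝ≥0) : ℝ≥0∞) ∧
        ∀ (n : ℕ) (φ : X → ℝ), Measurable φ → (∀ x, |φ x| ≤ 1 + β * V x) → ∀ x,
          |∫ z, φ z ∂((P ^ n) x) - ∫ z, φ z ∂μ| ≤
            abar ^ n * (2 + β * V x + β * (∫⁻ z, V z ∂μ).toReal)) := by
  obtain ⟨abar, β, h0, h1, hβ, hcontr⟩ := exists_contraction P hV hγ hdrift hα hR hminor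
  refine ⟨abar, β, h0, h1, hβ, fun n φ hφm M hM hφ x y =>
    abs_integral_pow_sub_le P hV hγ hdrift hcontr h0.le n hφm hM hφ x y,
    fun μ₁ μ₂ _ _ hμ₁ hμ₂ => invariant_unique P hV hγ hdrift hβ.le hcontr h0.le h1 hμ₁ hμ₂,
    fun μ _ hμ => ⟨lintegral_le_of_invariant P hV hγ hdrift hμ, fun n φ hφm hφ x => ?_⟩⟩
  have hLip : ∀ x y, |φ x - φ y| ≤ (1 : ℝ) * (2 + β * V x + β * V y) := by
    intro x y
    have := abs_sub (φ x) (φ y)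
    linarith [hφ x, hφ y]
  simpa using abs_integral_pow_sub_integral_le P hV hγ hdrift hcontr h0.le hμ n hφm zero_le_one
    hLip x

end Literature.Probability.Process.Harris
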